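import Mathlib.Data.Matrix.Block
import Mathlib.LinearAlgebra.Matrix.SemiringInverse
import Mathlib.LinearAlgebra.Matrix.Notation
import Mathlib.Tactic.NoncommRing
import HarnessLib

/-!
# Kapustin–Orlov's complex structures `𝓘(I, B)`, `𝓙(G, I, B)` on `T × T*` in kernel form: both are
# `B`-field transforms of the `B = 0` structures; squares `−1`; `q`-orthogonality; they commute;
# `𝓘 = 𝓘̃ ⟺ B I + Iᵗ B = 0`; `𝓙` depends on `(G, I)` only through `ω = G I`

Venture cell `pub-hsemireg`, literature seat `lit-w-polishchuk-orlov` (g12, 2026-08-25). Companion of the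
`OrlovIsometryGroup*.lean` files (not imported; they model Orlov's `U(A × Â)`, the isometry group of the hyperbolic
form `q` on `Λ ⊕ Λ*`): over the SAME `q`, the two block operators Kapustin–Orlov attach to a complex torus with a
Kähler metric and a `B`-field — the refereed origin of the «structure operator `𝒥_α`» of the 2024–26
twisted-equivalence preprints (locator sheet `widen/LIT-W/LITW-POLISHCHUK-ORLOV-…` §N).

PRINTED ([KapustinOrlov2003VertexAlgebrasTori] = A. Kapustin, D. Orlov, «Vertex algebras, mirror symmetry, and
D-branes: the case of complex tori», Comm. Math. Phys. 233 (2003) 79–136, §2.1; quoted from the arXiv:hep-th/0010293v2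
PDF, p. 8 L5–L77, p. 9 L1–L11 = printed pp. 7–8; carrier `widen/LIT-W/texts-po/ko03v2/`): «Let `I` be a (constant)
complex structure on `T`, `G` be a flat Kähler metric on `T`, and `b ∈ H²(T, ℝ)`. We will represent `b` by a constant
2-form `B` … a natural `ℤ`-valued symmetric bilinear form `q` on `Γ ⊕ Γ*` defined by `q((w₁, m₁), (w₂, m₂)) = l(w₁,
m₂) + l(w₂, m₁)` … Given `G, I, B`, we can define two complex structures on `T × T*`: `𝓘(I, B) = (I 0; BI + IᵗB −Iᵗ)`
(3), `𝓙(G, I, B) = (−IG⁻¹B IG⁻¹; GI − BIG⁻¹B BIG⁻¹)` (4). … `G` and `B` are regarded as elements of `Hom(U, U*)`, and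
`Iᵗ` denotes the endomorphism of `U*` conjugate to `I`. … `𝓙` depends on `G, I` only in the combination `ω = GI` … a
third natural complex structure … `𝓘̃ = (I 0; 0 −Iᵗ)`. … `𝓘` coincides with `𝓘̃` if and only if `B^{(0,2)} = 0`.»; THM
2.1: «`Vert(Γ, I, G, B)` is isomorphic to `Vert(Γ′, I′, G′, B′)` if and only if there exists an isomorphism of
lattices `Γ ⊕ Γ*` and `Γ′ ⊕ Γ′*` which takes `q` to `q′`, `𝓘` to `𝓘′`, and `𝓙` to `𝓙′`.»

MODEL (the one modelling step, ASSUMED): bases of `U ≅ Rⁿ` and the dual basis of `U*` are fixed; `I, G, B` are `n × n`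
matrices over a commutative ring `R`, `Iᵗ = Iᵀ`, `End(U ⊕ U*) = Matrix (n ⊕ n) (n ⊕ n) R` via `Matrix.fromBlocks`, `q
= (0 1; 1 0)`; «Kähler metric» = `Gᵀ = G ∧ Iᵀ G I = G`, «2-form» = `Bᵀ = −B`, «complex structure» = `I² = −1`, and
`G⁻¹` is a second matrix `G'` with `G G' = 1 = G' G`.

## Results (PROVED; 0 named fact, 0 `sorry`; imports Mathlib + HarnessLib; every `def` is a matrix)
* `bTransform B = (1 0; B 1)` [folklore `B`-transform; = «exp(B)» of the 2026 preprint [ChenLiZhang2026…] §2.2]: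
  `bTransform_mul`, and `bTransform_orthogonal_iff`: **`(e^B)ᵀ q e^B = q ⟺ Bᵀ = −B`** (⇐ is that preprint's sentence
  «preserves the bilinear form q because B is skew-symmetric»).
* `koI_eq_conj`, `koJ_eq_conj`: **`𝓘(I, B) = e^B 𝓘̃(I) e^{−B}`, `𝓙(G, I, B) = e^B 𝓙(G, I, 0) e^{−B}`** with NO
  hypothesis — (3), (4) ARE `B`-transforms of `𝓘̃` and `𝓙₀ = (0 IG⁻¹; GI 0)` (`koJ_zero`); hence `bTransform_conj_koI`
  / `_koJ`: `e^{B'} 𝓘(I, B) e^{−B'} = 𝓘(I, B' + B)`. DERIVED relative to [KO03]; the `𝓘` half is PRINTED in 2026 as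
  «𝒥_α := exp(B) ∘ 𝒥₀ ∘ exp(B)⁻¹» ([ChenLiZhang2026…] §2.2, Def. 2.3 «twisted Orlov lattice»; PREPRINT).
* `koItilde_sq`, `koI_sq`, `koJ_sq`: `I² = −1 ⟹ 𝓘̃² = 𝓘(I, B)² = −1` for EVERY `B`, and with `G G' = 1 = G' G` also
  `𝓙(G, I, B)² = −1` («two complex structures on `T × T*`»); `koItilde_orthogonal`, `koI_orthogonal`, `koJ_orthogonal`:
  `Xᵀ q X = q` under `I² = −1` (+ `Bᵀ = −B`; + `G, G'` symmetric, `Iᵀ G I = G`, `G G' = 1 = G' G` for `𝓙`);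
  `koI_mul_koJ_comm`: `𝓘 𝓙 = 𝓙 𝓘` under `I² = −1`, `Iᵀ G I = G`, `G G' = 1 = G' G`, any `B`. DERIVED HERE.
* `koI_eq_koItilde_iff`: **`𝓘(I, B) = 𝓘̃(I) ⟺ B I + Iᵀ B = 0`** (no hypothesis); `…_iff_invariant`: `⟺ Iᵀ B I = B` for
  `I² = −1` — the matrix form of «iff `B^{(0,2)} = 0`» (for a REAL 2-form `B^{(0,2)} = 0 ⟺ B` is of type (1,1) `⟺
  B(Ix, Iy) = B(x, y)`; this dictionary step is [folklore], docstring only); `koI_add_eq_iff` (`𝓘(I, B' + B) = 𝓘(I, B)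
  ⟺ B' I + Iᵀ B' = 0`) and `diagNeg_mul_koI_mul_diagNeg` (`B ↦ −B` is a conjugation) are Rem 6.6 ∕ Rem 6.4 (2) of the
  2026 preprint [LiLuTang2025DerivedIsogenies] (arXiv:2510.22612v3), whose operator `𝒥_α` IS (3) («consistent with
  [KO03, §2]», Rem 6.4 (1)).
* `koJ_eq_omega`: **`𝓙(G, I, B) = (ω'B −ω'; ω + Bω'B −Bω')`** for `ω = G I`, `ω' = −I G'` (mutually inverse:
  `omega_mul_omegaInv`) — the printed «depends on `G, I` only in the combination `ω = GI`».
* `integralShift_criterion`: for `B'ᵀ = −B'` over `R` (read `ℤ`) `e^{B'}` is invertible, preserves `q` and carries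
  `𝓘(I, B) ↦ 𝓘(I, B' + B)`, `𝓙(G, I, B) ↦ 𝓙(G, I, B' + B)` — the lattice half of Theorem 2.1's criterion for an
  integral shift of the `B`-field; the vertex-algebra side is NOT formalised.
* Non-vacuity over `ℤ`: `example_hypotheses` (`n = 2`: `I = (1 1; −2 −1)`, `G = (2 1; 1 1)`, `G' = (1 −1; −1 2)`, `B =
  (0 1; −1 0) ≠ 0` meet every hypothesis; there `𝓘 = 𝓘̃` — on a curve every 2-form is (1,1)); `example_dimension_four`
  (`I = i ⊕ i` on `ℤ⁴`: `Re(dz₁ ∧ dz₂)` gives `𝓘 ≠ 𝓘̃`, `dx₁ ∧ dy₁` gives `𝓘 = 𝓘̃` — the «`B^{(0,2)} = 0`» clause is a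
  genuine condition).

HONEST FRAMING: identities between block matrices over a commutative ring; the dictionary «torus with Kähler metric
and `B`-field ↦ (I, G, B)» is the print's own (§2.1) and is ASSUMED; nothing here constructs a torus, a vertex
algebra, a derived category, a gerbe or a twisted sheaf, nothing decides any equivalence, and nothing here says that
HC, HC_CM or HC_AV holds.
-/

namespace Summit.Ventures.HSemireg.KapustinOrlov

open Matrix

variable {R : Type*} [CommRing R] {n : Type*} [Fintype n] [DecidableEq n]

/-- The hyperbolic form `q((w₁, m₁), (w₂, m₂)) = l(w₁, m₂) + l(w₂, m₁)` on `U ⊕ U*` as the block matrix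
`(0 1; 1 0)` [cite: KapustinOrlov2003VertexAlgebrasTori, §2.1 (PDF p. 8 L27–L30)]; the same form as
Orlov's `Q_A` / GLO's `Q` (sheet §B). -/
def qForm (n : Type*) (R : Type*) [CommRing R] [DecidableEq n] : Matrix (n ⊕ n) (n ⊕ n) R :=
  fromBlocks 0 1 1 0

/-- The `B`-field transform `e^B = (1 0; B 1)` of `U ⊕ U*` [folklore; not a Kapustin–Orlov notation] = «exp(B)(ξ, η) :=
(ξ, η + B(ξ))» [cite: ChenLiZhang2026BlochTwistedAbelianSurfaces, §2.2 (arXiv v2 p. 9 L17–L18; PREPRINT)]. -/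
def bTransform (B : Matrix n n R) : Matrix (n ⊕ n) (n ⊕ n) R := fromBlocks 1 0 B 1

/-- Kapustin–Orlov's product complex structure `𝓘̃ = (I 0; 0 −Iᵗ)`
[cite: KapustinOrlov2003VertexAlgebrasTori, §2.1 (PDF p. 8 L65–L75)]. -/
def koItilde (I : Matrix n n R) : Matrix (n ⊕ n) (n ⊕ n) R := fromBlocks I 0 0 (-Iᵀ)

/-- Kapustin–Orlov's `𝓘(I, B) = (I 0; BI + IᵗB −Iᵗ)`, eq. (3)
[cite: KapustinOrlov2003VertexAlgebrasTori, §2.1 eq. (3) (PDF p. 8 L32–L40)]. -/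
def koI (I B : Matrix n n R) : Matrix (n ⊕ n) (n ⊕ n) R := fromBlocks I 0 (B * I + Iᵀ * B) (-Iᵀ)

/-- Kapustin–Orlov's `𝓙(G, I, B) = (−IG⁻¹B IG⁻¹; GI − BIG⁻¹B BIG⁻¹)`, eq. (4), with `G⁻¹` carried as
a matrix `G'` [cite: KapustinOrlov2003VertexAlgebrasTori, §2.1 eq. (4) (PDF p. 8 L41–L49)]. -/
def koJ (G G' I B : Matrix n n R) : Matrix (n ⊕ n) (n ⊕ n) R :=
  fromBlocks (-(I * G' * B)) (I * G') (G * I - B * I * G' * B) (B * I * G')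

omit [Fintype n] in
/-- `e^0 = 1`. -/
theorem bTransform_zero : bTransform (0 : Matrix n n R) = 1 := by
  rw [bTransform, fromBlocks_one]

/-- `e^B e^{B'} = e^{B + B'}`. [folklore] -/
theorem bTransform_mul (B B' : Matrix n n R) :
    bTransform B * bTransform B' = bTransform (B + B') := by
  simp only [bTransform, fromBlocks_multiply, Matrix.mul_one, Matrix.one_mul, Matrix.mul_zero,
    Matrix.zero_mul, add_zero, zero_add]

/-- `e^{−B} e^B = 1`. -/
theorem bTransform_neg_mul_self (B : Matrix n n R) : bTransform (-B) * bTransform B = 1 := by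
  rw [bTransform_mul, neg_add_cancel, bTransform_zero]

/-- `e^B e^{−B} = 1`. -/
theorem bTransform_mul_neg_self (B : Matrix n n R) : bTransform B * bTransform (-B) = 1 := by
  rw [bTransform_mul, add_neg_cancel, bTransform_zero]

/-- **The `B`-transform is a `q`-isometry iff `B` is antisymmetric** (a 2-form): `(e^B)ᵀ q e^B = (Bᵀ + B 1; 1 0)`.
DERIVED HERE. -/
theorem bTransform_orthogonal_iff (B : Matrix n n R) :
    (bTransform B)ᵀ * qForm n R * bTransform B = qForm n R ↔ Bᵀ = -B := by
  have h : (bTransform B)ᵀ * qForm n R * bTransform B = fromBlocks (Bᵀ + B) 1 1 0 := by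
    simp only [qForm, bTransform, fromBlocks_transpose, transpose_one, transpose_zero, fromBlocks_multiply,
      Matrix.mul_one, Matrix.one_mul, Matrix.mul_zero, Matrix.zero_mul, add_zero, zero_add]
  rw [h, qForm, fromBlocks_inj]
  exact ⟨fun h => eq_neg_of_add_eq_zero_left h.1, fun h => ⟨by rw [h, neg_add_cancel], rfl, rfl, rfl⟩⟩

omit [DecidableEq n] in
/-- `𝓙(G, I, 0) = (0 IG⁻¹; GI 0) =: 𝓙₀`. -/
theorem koJ_zero (G G' I : Matrix n n R) : koJ G G' I 0 = fromBlocks 0 (I * G') (G * I) 0 := by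
  simp only [koJ, Matrix.zero_mul, Matrix.mul_zero, neg_zero, sub_zero]

/-- **`𝓘(I, B) = e^B · 𝓘̃(I) · e^{−B}`** for all square matrices `I, B`. DERIVED HERE relative to [KO03] (which prints
(3) outright); PRINTED as «𝒥_α := exp(B) ∘ 𝒥₀ ∘ exp(B)⁻¹ = (J_X 0; BJ_X + J_XᵀB −J_Xᵀ)» with `𝒥₀ = (J_X 0; 0 −J_Xᵀ)` in
[cite: ChenLiZhang2026BlochTwistedAbelianSurfaces, §2.2 (arXiv v2 p. 9 L3–L31; PREPRINT)]. -/
theorem koI_eq_conj (I B : Matrix n n R) :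
    koI I B = bTransform B * koItilde I * bTransform (-B) := by
  simp only [koI, bTransform, koItilde, fromBlocks_multiply, Matrix.mul_one, Matrix.one_mul,
    Matrix.mul_zero, Matrix.zero_mul, add_zero, zero_add, Matrix.mul_neg, Matrix.neg_mul, neg_neg,
    neg_zero]

/-- **`𝓙(G, I, B) = e^B · 𝓙(G, I, 0) · e^{−B}`** for all square matrices `G, G', I, B`. DERIVED HERE. -/
theorem koJ_eq_conj (G G' I B : Matrix n n R) :
    koJ G G' I B = bTransform B * koJ G G' I 0 * bTransform (-B) := by
  simp only [koJ, bTransform, fromBlocks_multiply, Matrix.mul_one, Matrix.one_mul, Matrix.mul_zero,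
    Matrix.zero_mul, add_zero, zero_add, Matrix.mul_neg, neg_zero, sub_eq_add_neg, Matrix.mul_assoc]

/-- `e^{B'} 𝓘(I, B) e^{−B'} = 𝓘(I, B + B')`: shifting the `B`-field. DERIVED HERE. -/
theorem bTransform_conj_koI (I B B' : Matrix n n R) :
    bTransform B' * koI I B * bTransform (-B') = koI I (B' + B) := by
  rw [koI_eq_conj, koI_eq_conj I (B' + B), neg_add_rev, ← bTransform_mul B' B,
    ← bTransform_mul (-B) (-B')]
  simp only [Matrix.mul_assoc]

/-- `e^{B'} 𝓙(G, I, B) e^{−B'} = 𝓙(G, I, B + B')`: shifting the `B`-field. DERIVED HERE. -/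
theorem bTransform_conj_koJ (G G' I B B' : Matrix n n R) :
    bTransform B' * koJ G G' I B * bTransform (-B') = koJ G G' I (B' + B) := by
  rw [koJ_eq_conj, koJ_eq_conj G G' I (B' + B), neg_add_rev, ← bTransform_mul B' B,
    ← bTransform_mul (-B) (-B')]
  simp only [Matrix.mul_assoc]

omit [Fintype n] in
/-- `(−1 0; 0 −1) = −1`. -/
private theorem fromBlocks_neg_one_eq :
    fromBlocks (-1) 0 0 (-1) = (-1 : Matrix (n ⊕ n) (n ⊕ n) R) := by
  rw [← fromBlocks_one, fromBlocks_neg, neg_zero]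

/-- `I² = −1 ⟹ 𝓘̃² = −1`. -/
theorem koItilde_sq {I : Matrix n n R} (hI : I * I = -1) : koItilde I * koItilde I = -1 := by
  have hIt : Iᵀ * Iᵀ = -1 := by rw [← transpose_mul, hI, transpose_neg, transpose_one]
  simp only [koItilde, fromBlocks_multiply, Matrix.mul_zero, Matrix.zero_mul, add_zero, zero_add,
    Matrix.neg_mul, Matrix.mul_neg, neg_neg, hI, hIt, neg_zero, fromBlocks_neg_one_eq]

/-- Conjugation preserves `X² = −1`. -/
private theorem conj_sq (P Pinv X : Matrix (n ⊕ n) (n ⊕ n) R) (hP : Pinv * P = 1)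
    (hX : X * X = -1) : (P * X * Pinv) * (P * X * Pinv) = -1 := by
  calc (P * X * Pinv) * (P * X * Pinv) = P * X * (Pinv * P) * X * Pinv := by
        simp only [Matrix.mul_assoc]
    _ = -1 * (P * Pinv) := by rw [hP, Matrix.mul_one, Matrix.mul_assoc P X X, hX]; noncomm_ring
    _ = -1 := by rw [mul_eq_one_comm.mp hP, Matrix.mul_one]

/-- **`𝓘(I, B)² = −1` for every `B`** (only `I² = −1` is used). DERIVED HERE. -/
theorem koI_sq {I : Matrix n n R} (hI : I * I = -1) (B : Matrix n n R) : koI I B * koI I B = -1 := by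
  rw [koI_eq_conj]
  exact conj_sq _ _ _ (bTransform_neg_mul_self B) (koItilde_sq hI)

/-- `𝓙(G, I, 0)² = −1` from `I² = −1`, `G G' = 1`, `G' G = 1`. -/
theorem koJ_zero_sq {G G' I : Matrix n n R} (hI : I * I = -1) (hGG' : G * G' = 1) (hG'G : G' * G = 1) :
    koJ G G' I 0 * koJ G G' I 0 = -1 := by
  have h1 : I * G' * (G * I) = -1 := by
    rw [Matrix.mul_assoc, ← Matrix.mul_assoc G' G I, hG'G, Matrix.one_mul, hI]
  have h2 : G * I * (I * G') = -1 := by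
    rw [Matrix.mul_assoc, ← Matrix.mul_assoc I I G', hI, Matrix.neg_mul, Matrix.one_mul,
      Matrix.mul_neg, hGG']
  simp only [koJ_zero, fromBlocks_multiply, Matrix.mul_zero, Matrix.zero_mul, add_zero, zero_add, h1,
    h2, fromBlocks_neg_one_eq]

/-- **`𝓙(G, I, B)² = −1` for every `B`** (uses `I² = −1`, `G G' = 1 = G' G` only). DERIVED HERE. -/
theorem koJ_sq {G G' I : Matrix n n R} (hI : I * I = -1) (hGG' : G * G' = 1) (hG'G : G' * G = 1)
    (B : Matrix n n R) : koJ G G' I B * koJ G G' I B = -1 := by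
  rw [koJ_eq_conj]
  exact conj_sq _ _ _ (bTransform_neg_mul_self B) (koJ_zero_sq hI hGG' hG'G)

/-- `𝓘̃` is a `q`-isometry whenever `I² = −1`. DERIVED HERE. -/
theorem koItilde_orthogonal {I : Matrix n n R} (hI : I * I = -1) :
    (koItilde I)ᵀ * qForm n R * koItilde I = qForm n R := by
  have hIt : Iᵀ * Iᵀ = -1 := by rw [← transpose_mul, hI, transpose_neg, transpose_one]
  simp only [koItilde, qForm, fromBlocks_transpose, fromBlocks_multiply, transpose_zero, transpose_neg,
    transpose_transpose, Matrix.mul_zero, Matrix.zero_mul, add_zero, zero_add, Matrix.mul_one,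
    Matrix.neg_mul, Matrix.mul_neg, hI, hIt, neg_neg, neg_zero]

/-- Conjugation by a `q`-isometry preserves `q`-isometries. -/
private theorem conj_orthogonal (P Pinv X : Matrix (n ⊕ n) (n ⊕ n) R) (hP : Pinv * P = 1)
    (hPq : Pᵀ * qForm n R * P = qForm n R) (hX : Xᵀ * qForm n R * X = qForm n R) :
    (P * X * Pinv)ᵀ * qForm n R * (P * X * Pinv) = qForm n R := by
  have hPinvq : Pinvᵀ * qForm n R * Pinv = qForm n R := by
    have hP' : P * Pinv = 1 := mul_eq_one_comm.mp hP
    calc Pinvᵀ * qForm n R * Pinv = Pinvᵀ * (Pᵀ * qForm n R * P) * Pinv := by rw [hPq]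
      _ = (P * Pinv)ᵀ * qForm n R * (P * Pinv) := by rw [transpose_mul]; simp only [Matrix.mul_assoc]
      _ = qForm n R := by rw [hP', transpose_one, Matrix.one_mul, Matrix.mul_one]
  calc (P * X * Pinv)ᵀ * qForm n R * (P * X * Pinv)
        = Pinvᵀ * (Xᵀ * (Pᵀ * qForm n R * P) * X) * Pinv := by
          rw [transpose_mul, transpose_mul]; simp only [Matrix.mul_assoc]
    _ = qForm n R := by rw [hPq, hX, hPinvq]

/-- **`𝓘(I, B)` is a `q`-isometry** for `I² = −1` and `B` antisymmetric. DERIVED HERE. -/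
theorem koI_orthogonal {I B : Matrix n n R} (hI : I * I = -1) (hB : Bᵀ = -B) :
    (koI I B)ᵀ * qForm n R * koI I B = qForm n R := by
  rw [koI_eq_conj]
  exact conj_orthogonal _ _ _ (bTransform_neg_mul_self B) ((bTransform_orthogonal_iff B).mpr hB)
    (koItilde_orthogonal hI)

/-- `𝓙(G, I, 0)` is a `q`-isometry for `G, G'` symmetric, `Iᵀ G I = G` (hermitian), `G G' = 1 = G' G`. -/
theorem koJ_zero_orthogonal {G G' I : Matrix n n R} (hG : Gᵀ = G) (hG' : G'ᵀ = G')
    (hherm : Iᵀ * G * I = G) (hGG' : G * G' = 1) (hG'G : G' * G = 1) :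
    (koJ G G' I 0)ᵀ * qForm n R * koJ G G' I 0 = qForm n R := by
  have h1 : Iᵀ * Gᵀ * (I * G') = 1 := by
    rw [hG, ← Matrix.mul_assoc, hherm, hGG']
  have h2 : G'ᵀ * Iᵀ * (G * I) = 1 := by
    rw [hG', Matrix.mul_assoc, ← Matrix.mul_assoc Iᵀ G I, hherm, hG'G]
  simp only [koJ_zero, qForm, fromBlocks_transpose, fromBlocks_multiply, transpose_zero, transpose_mul,
    Matrix.mul_zero, Matrix.zero_mul, add_zero, zero_add, Matrix.mul_one, h1, h2]

/-- **`𝓙(G, I, B)` is a `q`-isometry** under the Kähler-with-`B`-field hypotheses. DERIVED HERE. -/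
theorem koJ_orthogonal {G G' I B : Matrix n n R} (hG : Gᵀ = G) (hG' : G'ᵀ = G')
    (hherm : Iᵀ * G * I = G) (hGG' : G * G' = 1) (hG'G : G' * G = 1) (hB : Bᵀ = -B) :
    (koJ G G' I B)ᵀ * qForm n R * koJ G G' I B = qForm n R := by
  rw [koJ_eq_conj]
  exact conj_orthogonal _ _ _ (bTransform_neg_mul_self B) ((bTransform_orthogonal_iff B).mpr hB)
    (koJ_zero_orthogonal hG hG' hherm hGG' hG'G)

/-- From `I² = −1`, `Iᵀ G I = G`, `G G' = 1 = G' G`: `I G' Iᵀ = G'` (`G⁻¹` is `I`-hermitian too). -/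
theorem mul_inv_mul_transpose_eq {G G' I : Matrix n n R} (hI : I * I = -1) (hherm : Iᵀ * G * I = G)
    (hGG' : G * G' = 1) (hG'G : G' * G = 1) : I * G' * Iᵀ = G' := by
  have hIt : Iᵀ * G = -(G * I) := by
    calc Iᵀ * G = Iᵀ * G * (I * I) * (-1) := by rw [hI]; noncomm_ring
      _ = -(G * I) := by rw [← Matrix.mul_assoc _ I I, hherm]; noncomm_ring
  calc I * G' * Iᵀ = I * G' * (Iᵀ * G) * G' := by
        rw [Matrix.mul_assoc _ (Iᵀ * G) G', Matrix.mul_assoc Iᵀ G G', hGG', Matrix.mul_one]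
    _ = -(I * (G' * G) * I) * G' := by rw [hIt]; noncomm_ring
    _ = G' := by rw [hG'G, Matrix.mul_one, hI, neg_neg, Matrix.one_mul]

/-- `𝓘̃ 𝓙₀ = 𝓙₀ 𝓘̃` under `I² = −1`, `Iᵀ G I = G`, `G G' = 1 = G' G`. -/
theorem koItilde_mul_koJ_zero_comm {G G' I : Matrix n n R} (hI : I * I = -1) (hherm : Iᵀ * G * I = G)
    (hGG' : G * G' = 1) (hG'G : G' * G = 1) :
    koItilde I * koJ G G' I 0 = koJ G G' I 0 * koItilde I := by
  have h1 : I * (I * G') = -G' := by rw [← Matrix.mul_assoc, hI, Matrix.neg_mul, Matrix.one_mul]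
  have h2 : -Iᵀ * (G * I) = -G := by rw [Matrix.neg_mul, ← Matrix.mul_assoc, hherm]
  have h3 : I * G' * -Iᵀ = -G' := by rw [Matrix.mul_neg, mul_inv_mul_transpose_eq hI hherm hGG' hG'G]
  have h4 : G * I * I = -G := by rw [Matrix.mul_assoc, hI, Matrix.mul_neg, Matrix.mul_one]
  simp only [koItilde, koJ_zero, fromBlocks_multiply, Matrix.mul_zero, Matrix.zero_mul, add_zero,
    zero_add, h1, h2, h3, h4]

/-- Conjugation preserves commuting pairs. -/
private theorem conj_comm (P Pinv X Y : Matrix (n ⊕ n) (n ⊕ n) R) (hP : Pinv * P = 1)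
    (h : X * Y = Y * X) : P * X * Pinv * (P * Y * Pinv) = P * Y * Pinv * (P * X * Pinv) := by
  calc P * X * Pinv * (P * Y * Pinv) = P * (X * (Pinv * P) * Y) * Pinv := by simp only [Matrix.mul_assoc]
    _ = P * (Y * (Pinv * P) * X) * Pinv := by rw [hP, Matrix.mul_one, Matrix.mul_one, h]
    _ = P * Y * Pinv * (P * X * Pinv) := by simp only [Matrix.mul_assoc]

/-- **`𝓘(I, B) 𝓙(G, I, B) = 𝓙(G, I, B) 𝓘(I, B)`** (the commuting pair behind `Vert(Γ, I, G, B)`), under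
`I² = −1`, `Iᵀ G I = G`, `G G' = 1 = G' G`; no hypothesis on `B`. DERIVED HERE. -/
theorem koI_mul_koJ_comm {G G' I : Matrix n n R} (hI : I * I = -1) (hherm : Iᵀ * G * I = G)
    (hGG' : G * G' = 1) (hG'G : G' * G = 1) (B : Matrix n n R) :
    koI I B * koJ G G' I B = koJ G G' I B * koI I B := by
  rw [koI_eq_conj, koJ_eq_conj]
  exact conj_comm _ _ _ _ (bTransform_neg_mul_self B) (koItilde_mul_koJ_zero_comm hI hherm hGG' hG'G)

omit [Fintype n] [DecidableEq n] in
/-- Lower-triangular block matrices with equal diagonal agree iff their lower-left blocks do. -/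
private theorem fromBlocks_eq_iff_lower {a d c c' : Matrix n n R} :
    fromBlocks a 0 c d = fromBlocks a 0 c' d ↔ c = c' := by
  rw [fromBlocks_inj]
  exact ⟨fun h => h.2.2.1, fun h => ⟨rfl, rfl, h, rfl⟩⟩

omit [DecidableEq n] in
/-- **`𝓘(I, B) = 𝓘̃(I) ⟺ B I + Iᵀ B = 0`** (no hypothesis). Matrix form of «`𝓘` coincides with `𝓘̃` if
and only if `B^{(0,2)} = 0`» [cite: KapustinOrlov2003VertexAlgebrasTori, §2.1 (PDF p. 8 L76–L77)]. -/
theorem koI_eq_koItilde_iff (I B : Matrix n n R) : koI I B = koItilde I ↔ B * I + Iᵀ * B = 0 :=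
  fromBlocks_eq_iff_lower

/-- For `I² = −1`: `B I + Iᵀ B = 0 ⟺ Iᵀ B I = B` (`B(Ix, Iy) = B(x, y)`: `B` is `I`-invariant, i.e. of
type (1,1) for a real form — the [folklore] reading of `B^{(0,2)} = 0`). DERIVED HERE. -/
theorem mul_add_transpose_mul_eq_zero_iff {I : Matrix n n R} (hI : I * I = -1) (B : Matrix n n R) :
    B * I + Iᵀ * B = 0 ↔ Iᵀ * B * I = B := by
  constructor
  · intro h
    have h' : Iᵀ * B = -(B * I) := eq_neg_of_add_eq_zero_right h
    rw [h', Matrix.neg_mul, Matrix.mul_assoc, hI, Matrix.mul_neg, Matrix.mul_one, neg_neg]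
  · intro h
    calc B * I + Iᵀ * B = B * I + Iᵀ * B * (I * I) * (-1) := by rw [hI]; noncomm_ring
      _ = 0 := by rw [← Matrix.mul_assoc _ I I, h]; noncomm_ring

/-- **`𝓘(I, B) = 𝓘̃(I) ⟺ Iᵀ B I = B`** for `I² = −1`. DERIVED HERE. -/
theorem koI_eq_koItilde_iff_invariant {I : Matrix n n R} (hI : I * I = -1) (B : Matrix n n R) :
    koI I B = koItilde I ↔ Iᵀ * B * I = B :=
  (koI_eq_koItilde_iff I B).trans (mul_add_transpose_mul_eq_zero_iff hI B)

omit [DecidableEq n] in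
/-- **`𝓘(I, B' + B) = 𝓘(I, B) ⟺ B' I + Iᵀ B' = 0`** (no hypothesis) — matrix form of «`𝒥_α` depends only on `J` and `α`,
not on the choice of `B_α`» [cite: LiLuTang2025DerivedIsogenies, Rem 6.6 (arXiv v3 p. 38; PREPRINT)] (an integral
`c₁(L)`, `L ∈ Pic(X)`, is `I`-invariant, i.e. of type (1,1)). DERIVED HERE. -/
theorem koI_add_eq_iff (I B B' : Matrix n n R) : koI I (B' + B) = koI I B ↔ B' * I + Iᵀ * B' = 0 := by
  rw [koI, koI, fromBlocks_inj, Matrix.add_mul, Matrix.mul_add, add_add_add_comm, add_eq_right]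
  exact ⟨fun h => h.2.2.1, fun h => ⟨rfl, rfl, h, rfl⟩⟩

/-- **`diag(−1, 1) · 𝓘(I, B) · diag(−1, 1) = 𝓘(I, −B)`** [cite: LiLuTang2025DerivedIsogenies, Rem 6.4 (2) (arXiv v3
p. 35; PREPRINT)], whose `𝒥_α` is (3) letter for letter («… consistent with [KO03, §2]», Rem 6.4 (1)). DERIVED HERE. -/
theorem diagNeg_mul_koI_mul_diagNeg (I B : Matrix n n R) :
    fromBlocks (-1) 0 0 1 * koI I B * fromBlocks (-1) 0 0 1 = koI I (-B) := by
  simp only [koI, fromBlocks_multiply, Matrix.mul_zero, Matrix.zero_mul, add_zero, zero_add,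
    Matrix.neg_mul, Matrix.mul_neg, Matrix.one_mul, Matrix.mul_one, neg_neg, neg_zero, neg_add_rev]
  rw [add_comm]

/-- `ω ω' = 1 = ω' ω` for `ω := G I`, `ω' := −I G'`, given `I² = −1`, `G G' = 1 = G' G`. -/
theorem omega_mul_omegaInv {G G' I : Matrix n n R} (hI : I * I = -1) (hGG' : G * G' = 1)
    (hG'G : G' * G = 1) : G * I * -(I * G') = 1 ∧ -(I * G') * (G * I) = 1 := by
  constructor
  · rw [Matrix.mul_neg, Matrix.mul_assoc, ← Matrix.mul_assoc I I G', hI, Matrix.neg_mul,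
      Matrix.one_mul, Matrix.mul_neg, hGG', neg_neg]
  · rw [Matrix.neg_mul, Matrix.mul_assoc, ← Matrix.mul_assoc G' G I, hG'G, Matrix.one_mul, hI, neg_neg]

omit [DecidableEq n] in
/-- **`𝓙(G, I, B) = (ω'B −ω'; ω + Bω'B −Bω')`** with `ω = G I`, `ω' = −I G'`: an identity for all
matrices (no hypothesis) — «`𝓙` depends on `G, I` only in the combination `ω = GI`»
[cite: KapustinOrlov2003VertexAlgebrasTori, §2.1 (PDF p. 8 L62–L65)], DERIVED HERE in matrix form. -/
theorem koJ_eq_omega (G G' I B ω ω' : Matrix n n R) (hω : ω = G * I) (hω' : ω' = -(I * G')) :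
    koJ G G' I B = fromBlocks (ω' * B) (-ω') (ω + B * ω' * B) (-(B * ω')) := by
  subst hω hω'
  simp only [koJ, Matrix.neg_mul, Matrix.mul_neg, neg_neg, sub_eq_add_neg, Matrix.mul_assoc]

/-- Same lattice `Γ′ = Γ`, same `I`, `G`, the `B`-field shifted by an INTEGRAL 2-form: for `B'ᵀ = −B'` with entries in `R`
(read `ℤ`) `e^{B'} : Γ ⊕ Γ* → Γ ⊕ Γ*` is invertible (inverse `e^{−B'}`), takes `q` to `q`, `𝓘(I, B)` to `𝓘(I, B' + B)` and
`𝓙(G, I, B)` to `𝓙(G, I, B' + B)`: the `(q, 𝓘, 𝓙)`-data of `(Γ, I, G, B)` and `(Γ, I, G, B' + B)` are isomorphic in the sense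
of [cite: KapustinOrlov2003VertexAlgebrasTori, Thm 2.1 (PDF p. 9 L1–L11)] — the lattice half only; no vertex algebra. -/
theorem integralShift_criterion (G G' I B B' : Matrix n n R) (hB' : B'ᵀ = -B') :
    bTransform (-B') * bTransform B' = 1 ∧ bTransform B' * bTransform (-B') = 1 ∧
      (bTransform B')ᵀ * qForm n R * bTransform B' = qForm n R ∧
      bTransform B' * koI I B * bTransform (-B') = koI I (B' + B) ∧
      bTransform B' * koJ G G' I B * bTransform (-B') = koJ G G' I (B' + B) :=
  ⟨bTransform_neg_mul_self B', bTransform_mul_neg_self B', (bTransform_orthogonal_iff B').mpr hB',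
    bTransform_conj_koI I B B', bTransform_conj_koJ G G' I B B'⟩

section Example

/-- `I = (1 1; −2 −1)`: a complex structure on `ℤ²` (`I² = −1`) other than `±(0 −1; 1 0)`. -/
def exampleI : Matrix (Fin 2) (Fin 2) ℤ := !![1, 1; -2, -1]
/-- `G = (2 1; 1 1)`: symmetric, unimodular and `I`-hermitian for `exampleI`. -/
def exampleG : Matrix (Fin 2) (Fin 2) ℤ := !![2, 1; 1, 1]
/-- `G' = G⁻¹ = (1 −1; −1 2)`. -/
def exampleG' : Matrix (Fin 2) (Fin 2) ℤ := !![1, -1; -1, 2]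
/-- `B = (0 1; −1 0)`, an integral 2-form on `ℤ²`. -/
def exampleB : Matrix (Fin 2) (Fin 2) ℤ := !![0, 1; -1, 0]

/-- Every hypothesis used above (`I² = −1`, `Gᵀ = G`, `G'ᵀ = G'`, `Iᵀ G I = G`, `G G' = 1 = G' G`, `Bᵀ = −B`) holds for this
non-scalar integral instance with `B ≠ 0`, and `𝓘(I, B) = 𝓘̃(I)` there: on a curve every 2-form is of type (1,1). -/
theorem example_hypotheses :
    exampleI * exampleI = -1 ∧ exampleGᵀ = exampleG ∧ exampleG'ᵀ = exampleG' ∧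
      exampleIᵀ * exampleG * exampleI = exampleG ∧ exampleG * exampleG' = 1 ∧
      exampleG' * exampleG = 1 ∧ exampleBᵀ = -exampleB ∧ exampleB ≠ 0 ∧
      koI exampleI exampleB = koItilde exampleI := by
  decide

/-- `I₄ = (0 −1; 1 0) ⊕ (0 −1; 1 0)`: the standard complex structure on `ℤ⁴` (`x₁, y₁, x₂, y₂`). -/
def exampleI₄ : Matrix (Fin 4) (Fin 4) ℤ := !![0, -1, 0, 0; 1, 0, 0, 0; 0, 0, 0, -1; 0, 0, 1, 0]
/-- `B₄ = dx₁ ∧ dx₂ − dy₁ ∧ dy₂ = Re(dz₁ ∧ dz₂)`: an integral 2-form of type (2,0) + (0,2). -/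
def exampleB₄ : Matrix (Fin 4) (Fin 4) ℤ := !![0, 0, 1, 0; 0, 0, 0, -1; -1, 0, 0, 0; 0, 1, 0, 0]
/-- `B₄' = dx₁ ∧ dy₁`: an integral 2-form of type (1,1). -/
def exampleB₄' : Matrix (Fin 4) (Fin 4) ℤ := !![0, 1, 0, 0; -1, 0, 0, 0; 0, 0, 0, 0; 0, 0, 0, 0]

/-- Real dimension `4`: `I₄² = −1`, `I₄ᵀ I₄ = 1`, `B₄`, `B₄'` antisymmetric, `𝓘(I₄, B₄) ≠ 𝓘̃(I₄)` but `𝓘(I₄, B₄') = 𝓘̃(I₄)`. -/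
theorem example_dimension_four :
    exampleI₄ * exampleI₄ = -1 ∧ exampleI₄ᵀ * 1 * exampleI₄ = 1 ∧ exampleB₄ᵀ = -exampleB₄ ∧
      exampleB₄'ᵀ = -exampleB₄' ∧ koI exampleI₄ exampleB₄ ≠ koItilde exampleI₄ ∧
      koI exampleI₄ exampleB₄' = koItilde exampleI₄ := by
  decide

end Example

end Summit.Ventures.HSemireg.KapustinOrlov
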